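/-
Copyright (c) 2026 the pub-hodgecm-mathlib formalisation cell (harness21).  Prover seat hodgecm-mathlib-LH4-p05 (g8), Track A «(D-RAM) FOUR-FRAME» squad, helper lane on
h413 = stmt-HodgeConjecture-24833 (count-neutral).  Heir dealer∕pen LH4-plan (g13) WORD #58 RULING B (ii) «(β) PRODUCER, statement-first»; (β) step (2b): the composition
«(α′) ∧ (A″) ∧ κ-balance ⇒ (β)».  2026-09-04.
-/
import Summits.HodgeConjecture.HodgeConjecture.Theorems.F0P3cDyRamCleanLabelDefs            -- ★ DEFS LEAF №7 (this seat): `cleanLabelFixCount`, (A″) `CleanLabelDichotomyLawAt`, (β-BAL) `CleanLabelKappaBalanceLawAt`; brings ★ №6 (α′)∕(β)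
import Summits.HodgeConjecture.HodgeConjecture.Theorems.F0P3cDyRamCleanSgnKappaForm          -- ★ p859891 (this seat): `cleanSgnFrameConstLawAt_of_forall_sum_kappaChar`
import Summits.HodgeConjecture.HodgeConjecture.Theorems.F0P3cDyRamLabelPlusCleanOfRecord     -- ★ p859831 (LH4-p13 (g8)): (α′) `labelPlusCleanLawAt_derived_ofRecord`
import Summits.HodgeConjecture.HodgeConjecture.Theorems.F0P3cDyRamFrameEltOneSlotLabel       -- ★ (LH4-p13): `valueSetMod_smul_xPlus_mul_norm`; brings ★ `…TableDiagWitnesses.not_labelPlus_smul_xPlus`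
import Literature.NumberTheory.LocalFields.WildQuadraticDatumNonNormUnit                      -- ★ `exists_unit_nonnorm_dichotomy_of_isRamifiedQuadraticDatum` (NI2 on the fixed units)
import Literature.NumberTheory.LocalFields.ValuedCompleteIsAdicComplete                       -- ★ `isAdicComplete_valuedInteger_of_completeSpace`
import HarnessLib

/-!
# Crux `H413`, line LH4 «(D-RAM) FOUR-FRAME» — (β) FROM THE LABEL DICHOTOMY AND THE κ-BALANCE OF THE TWO CLASSES:
# `LabelPlusCleanLawAt ∧ CleanLabelDichotomyLawAt ∧ CleanLabelKappaBalanceLawAt ⇒ CleanSgnFrameConstLawAt`, and the ED. 6 letter `stub_law_cleanSgn` modulo (A″) + (β-BAL)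

Cell `hodgecm-mathlib` (D-0151), FLOOR 0, crux item H413 = `stmt-HodgeConjecture-24833`, route `HCCMUnconditional`; squad F0∕P3c∕LH4.  THEOREMS ONLY (no `def`, no instance, no
notation, no `sorry`, default heartbeats); lane `--supports stmt-HodgeConjecture-24833 --as helper`; pays NO row, states NO law; import cone ∌ the (β) CONSUMER ★ p859751.

THE MATHEMATICS.  At a ramified datum, fix a frame literal `T = Γ_b` and write `ℓ₀ = d % 2`, `m* = mstarOfRecord d`, `m_c = mc d ≥ m*`.  (α′) says a `+`-labelled vertex of the
`(ℓ₀, m*)`-shell is clean (`(T−1)²M ⊆ ϖ^{m_c}M`), so `transvPlusFixCount (ℓ₀, m*) T = cleanLabelFixCount (ℓ₀, m*, m_c) 1 T` (§1, set equality; the other inclusion is `m* ≤ m_c`).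
(A″) says a clean-shell vertex has the value set of `e • X₊` for SOME `σ`-fixed unit `e`; by the index-two dictionary on the fixed units (★ NI2: `e` or `u·e` is a norm, `u` a fixed
non-norm unit) and norm-invariance of the reference value set (★ `valueSetMod_smul_xPlus_mul_norm`), that set is `V₊` or `V_u := valueSetMod (u • X₊)`, and `V_u ≠ V₊` at `m*`
(★ `not_labelPlus_smul_xPlus`); hence `cleanMinusFixCount (ℓ₀, m*, m_c) T = cleanLabelFixCount (ℓ₀, m*, m_c) u T` (§1).  So the κ-censuses of `#T+ − #T−′` are those of
`cleanLabelFixCount … 1 − cleanLabelFixCount … u`, which (β-BAL) makes vanish; ★ p859891 `cleanSgnFrameConstLawAt_of_forall_sum_kappaChar` closes (β) (§2).  §3 instantiates at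
the letters of record: with (α′) PROVED at `(n0DerivedOfRecord, mcOfRecord)` (★ p859831) the ED. 6 letter `stub_law_cleanSgn : ∀ σ ϖ d t, DyadicFence (CleanSgnFrameConstLawAt
n0DerivedOfRecord mcOfRecord σ ϖ d t)` follows from the two NEW letters (A″)∕(β-BAL) at the same schedules — its remaining producers (LH4-p13 (g8) ∕ the Stage-B strata engines).
* §1 `setOf_transvPlus_eq_setOf_cleanLabel_one`, `transvPlusFixCount_eq_cleanLabelFixCount_one`; `setOf_cleanMinus_eq_setOf_cleanLabel`, `cleanMinusFixCount_eq_cleanLabelFixCount`.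
* §2 HEAD `cleanSgnFrameConstLawAt_of_dichotomy_of_balance`; fenced form.
* §3 `dyadicFence_cleanSgnFrameConstLawAt_derived_ofRecord_of` (the ED. 6 letter modulo (A″) + (β-BAL) at the schedules of record).
HONEST LABEL.  Count-neutral composition; (A″), (β-BAL), (β) and the tier-0 T₊ row are OPEN; `HC_CM` is proved only modulo the 7 printed citations (2 remaining named inputs:
hLiu418 = `stmt-HodgeConjecture-24832`, h413 = `stmt-HodgeConjecture-24833`) until rung 0 closes.

## References
* [Rogawski1990] J. D. Rogawski, *Automorphic Representations of Unitary Groups in Three Variables*, Ann. of Math. Stud. 123 (1990): §4.9 Prop. 4.9.1 (a)(b) p. 55, §4.10 p. 58.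
* [Serre1979] J.-P. Serre, *Local Fields*, GTM 67 (1979), Ch. V §3 Cor. 3 (the norm subgroup of the units has index two).
* [LanglandsShelstad1987] R. P. Langlands, D. Shelstad, *On the definition of transfer factors*, Math. Ann. 278 (1987), §1.3, §3.
* [Kottwitz1986BaseChangeUnits] R. E. Kottwitz, *Base change for unit elements of Hecke algebras*, Compositio Math. 60 (1986), §1 pp. 240–241.
-/

set_option autoImplicit false

noncomputable section

namespace Summit.HodgeConjecture.HodgeConjecture.Cruxes.H413.F0P3cDyRamCleanSgnOfLabelDichotomy

open Literature.NumberTheory.Automorphic Literature.NumberTheory.Automorphic.HermitianLattice Literature.NumberTheory.Automorphic.UnitaryGroup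
open Literature.NumberTheory.Automorphic.UnitaryLatticeTree Literature.NumberTheory.Automorphic.UnitaryThreeFourFrame
open Literature.NumberTheory.LocalFields Literature.NumberTheory.LocalFields.WildQuadraticDatum
open Summit.HodgeConjecture.HodgeConjecture.Cruxes.H413.F0P3cDyRamFourFrameLawDefs (DyadicFence)
open Summit.HodgeConjecture.HodgeConjecture.Cruxes.H413.F0P3cDyRamFourFramePieces
open Summit.HodgeConjecture.HodgeConjecture.Cruxes.H413.F0P3cDyRamFourFrameCensusDefs
open Summit.HodgeConjecture.HodgeConjecture.Cruxes.H413.F0P3cDyRamStageOneBDefs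
open Summit.HodgeConjecture.HodgeConjecture.Cruxes.H413.F0P3cDyRamStageOneBDerivedDefs
open Summit.HodgeConjecture.HodgeConjecture.Cruxes.H413.F0P3cDyRamCleanLabelDefs
open Summit.HodgeConjecture.HodgeConjecture.Cruxes.H413.F0P3cDyRamCleanSgnKappaForm
open Summit.HodgeConjecture.HodgeConjecture.Cruxes.H413.F0P3cDyRamLabelPlusCleanOfRecord
open Summit.HodgeConjecture.HodgeConjecture.Cruxes.H413.F0P3cDyRamTableDiagWitnesses (not_labelPlus_smul_xPlus)
open Summit.HodgeConjecture.HodgeConjecture.Cruxes.H413.F0P3cDyRamFrameEltOneSlotLabel (valueSetMod_smul_xPlus_mul_norm)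
open scoped Matrix MatrixGroups WithZero Valued

/-! ## §1  The two profile counts as clean-label counts, at one literal `T` -/

section OneLiteral

variable {K : Type} [Field K] [Valued K ℤᵐ⁰]

/-- **`T+` ON THE SHELL = CLASS `1` ON THE CLEAN SHELL**, as sets, given (α′) at the literal `T` («`+`-labelled shell vertices are clean») and `m ≤ mc` (`|ϖ| ≤ 1`).
[cite: Rogawski1990, §4.9 Prop. 4.9.1 (b) p. 55] -/
theorem setOf_transvPlus_eq_setOf_cleanLabel_one (σ : K →+* K) {ϖ : K} (hϖ1 : Valued.v ϖ ≤ 1) (d ℓ : ℕ) {m mc : ℕ} (hm : m ≤ mc) (T : GL (Fin 3) K)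
    (hα : ∀ M : Submodule (Valued.integer K) (Fin 3 → K), IsVertexLattice σ ϖ ((StdForm.antidiagonal 3).over K) 0 M → mapGL T M = M →
      LatticeNearTransvShell ϖ ℓ m ((T : Matrix (Fin 3) (Fin 3) K) - 1) M → LatticeLabelPlus σ ϖ d m M ((T : Matrix (Fin 3) (Fin 3) K) - 1) →
      LatticeInLevel ϖ mc (((T : Matrix (Fin 3) (Fin 3) K) - 1) * ((T : Matrix (Fin 3) (Fin 3) K) - 1)) M) :
    {M : Submodule (Valued.integer K) (Fin 3 → K) | IsVertexLattice σ ϖ ((StdForm.antidiagonal 3).over K) 0 M ∧ mapGL T M = M ∧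
        LatticeNearTransvShell ϖ ℓ m ((T : Matrix (Fin 3) (Fin 3) K) - 1) M ∧ LatticeLabelPlus σ ϖ d m M ((T : Matrix (Fin 3) (Fin 3) K) - 1)} =
      {M : Submodule (Valued.integer K) (Fin 3 → K) | IsVertexLattice σ ϖ ((StdForm.antidiagonal 3).over K) 0 M ∧ mapGL T M = M ∧
        LatticeNearTransvShell ϖ ℓ mc ((T : Matrix (Fin 3) (Fin 3) K) - 1) M ∧
        latticeValueSetMod σ ϖ m M ((T : Matrix (Fin 3) (Fin 3) K) - 1) = valueSetMod σ ϖ m ((1 : K) • xPlus σ ϖ d)} := by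
  ext M
  simp only [Set.mem_setOf_eq, one_smul]
  constructor
  · rintro ⟨hV, hT, hsh, hL⟩
    exact ⟨hV, hT, ⟨hsh.1, hsh.2.1, hα M hV hT hsh hL⟩, hL⟩
  · rintro ⟨hV, hT, hsh, hL⟩
    exact ⟨hV, hT, ⟨hsh.1, hsh.2.1, hsh.2.2.trans (scaleLattice_pow_antitone hϖ1 M hm)⟩, hL⟩

/-- Hence `transvPlusFixCount σ ϖ d ℓ m T = cleanLabelFixCount σ ϖ d ℓ m mc 1 T` under (α′) at `T` and `m ≤ mc`. [cite: Rogawski1990, §4.9 Prop. 4.9.1 (b) p. 55] -/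
theorem transvPlusFixCount_eq_cleanLabelFixCount_one (σ : K →+* K) {ϖ : K} (hϖ1 : Valued.v ϖ ≤ 1) (d ℓ : ℕ) {m mc : ℕ} (hm : m ≤ mc) (T : GL (Fin 3) K)
    (hα : ∀ M : Submodule (Valued.integer K) (Fin 3 → K), IsVertexLattice σ ϖ ((StdForm.antidiagonal 3).over K) 0 M → mapGL T M = M →
      LatticeNearTransvShell ϖ ℓ m ((T : Matrix (Fin 3) (Fin 3) K) - 1) M → LatticeLabelPlus σ ϖ d m M ((T : Matrix (Fin 3) (Fin 3) K) - 1) →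
      LatticeInLevel ϖ mc (((T : Matrix (Fin 3) (Fin 3) K) - 1) * ((T : Matrix (Fin 3) (Fin 3) K) - 1)) M) :
    transvPlusFixCount σ ϖ d ℓ m T = cleanLabelFixCount σ ϖ d ℓ m mc 1 T := by
  unfold transvPlusFixCount cleanLabelFixCount
  rw [setOf_transvPlus_eq_setOf_cleanLabel_one σ hϖ1 d ℓ hm T hα]

/-- `|z| = 1` from `z·σz = e` with `|e| = 1` (`σ` isometric). [cite: Serre1979, Ch. V §3 Cor. 3] -/
theorem v_eq_one_of_mul_map_eq_unit {σ : K →+* K} (hvσ : ∀ a, Valued.v (σ a) = Valued.v a) {z e : K} (hz : z * σ z = e) (he : Valued.v e = 1) :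
    Valued.v z = 1 := by
  have h : Valued.v z * Valued.v z = 1 := by
    nth_rw 2 [← hvσ z]
    rw [← map_mul, hz, he]
  rw [← pow_two] at h
  exact ((pow_eq_one_iff).1 h).resolve_right two_ne_zero

/-- **`T−′` ON THE CLEAN SHELL = CLASS `u` ON THE CLEAN SHELL**, as sets, for a `σ`-fixed non-norm unit `u`, given (A″) at the literal `T` («clean ⇒ labelled by some unit
class»), the index-two dictionary on the fixed units relative to `u`, and `V_u ≠ V₊` at level `m`. [cite: Serre1979, Ch. V §3 Cor. 3] [cite: Rogawski1990, §4.9 Prop. 4.9.1 (b) p. 55] -/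
theorem setOf_cleanMinus_eq_setOf_cleanLabel {σ : K →+* K} (hvσ : ∀ a, Valued.v (σ a) = Valued.v a) (ϖ : K) (d ℓ m mc : ℕ) (T : GL (Fin 3) K) {u : K} (hσu : σ u = u) (hvu : Valued.v u = 1)
    (hdich : ∀ e : K, σ e = e → Valued.v e = 1 → (∃ z : K, z * σ z = e) ∨ ∃ z : K, z * σ z = u * e)
    (hne : valueSetMod σ ϖ m (u • xPlus σ ϖ d) ≠ valueSetMod σ ϖ m (xPlus σ ϖ d))
    (hA : ∀ M : Submodule (Valued.integer K) (Fin 3 → K), IsVertexLattice σ ϖ ((StdForm.antidiagonal 3).over K) 0 M → mapGL T M = M →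
      LatticeNearTransvShell ϖ ℓ mc ((T : Matrix (Fin 3) (Fin 3) K) - 1) M →
      ∃ e : K, σ e = e ∧ Valued.v e = 1 ∧ latticeValueSetMod σ ϖ m M ((T : Matrix (Fin 3) (Fin 3) K) - 1) = valueSetMod σ ϖ m (e • xPlus σ ϖ d)) :
    {M : Submodule (Valued.integer K) (Fin 3 → K) | IsVertexLattice σ ϖ ((StdForm.antidiagonal 3).over K) 0 M ∧ mapGL T M = M ∧
        LatticeNearTransvShell ϖ ℓ mc ((T : Matrix (Fin 3) (Fin 3) K) - 1) M ∧ ¬ LatticeLabelPlus σ ϖ d m M ((T : Matrix (Fin 3) (Fin 3) K) - 1)} =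
      {M : Submodule (Valued.integer K) (Fin 3 → K) | IsVertexLattice σ ϖ ((StdForm.antidiagonal 3).over K) 0 M ∧ mapGL T M = M ∧
        LatticeNearTransvShell ϖ ℓ mc ((T : Matrix (Fin 3) (Fin 3) K) - 1) M ∧
        latticeValueSetMod σ ϖ m M ((T : Matrix (Fin 3) (Fin 3) K) - 1) = valueSetMod σ ϖ m (u • xPlus σ ϖ d)} := by
  have hu0 : u ≠ 0 := fun h => by rw [h, map_zero] at hvu; exact zero_ne_one hvu
  ext M
  simp only [Set.mem_setOf_eq]
  constructor
  · rintro ⟨hV, hT, hsh, hL⟩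
    refine ⟨hV, hT, hsh, ?_⟩
    obtain ⟨e, hσe, hve, hMe⟩ := hA M hV hT hsh
    rcases hdich e hσe hve with ⟨z, hz⟩ | ⟨z, hz⟩
    · -- `e` a norm: the vertex would be `+`-labelled
      have hz1 : Valued.v z = 1 := v_eq_one_of_mul_map_eq_unit hvσ hz hve
      exfalso
      apply hL
      rw [LatticeLabelPlus, hMe, ← hz, ← one_mul (z * σ z), valueSetMod_smul_xPlus_mul_norm σ ϖ d m 1 hz1, one_smul]
    · -- `u·e` a norm: `e = u·N(z∕u)`
      have hw1 : Valued.v (z * u⁻¹) = 1 := by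
        have hz1 : Valued.v z = 1 := v_eq_one_of_mul_map_eq_unit hvσ hz (by rw [map_mul, hvu, hve, one_mul])
        rw [map_mul, map_inv₀, hz1, hvu, inv_one, one_mul]
      have he : u * (z * u⁻¹ * σ (z * u⁻¹)) = e := by
        rw [map_mul, map_inv₀, hσu]
        calc u * (z * u⁻¹ * (σ z * u⁻¹)) = z * σ z * u⁻¹ * (u * u⁻¹) := by ring
          _ = e := by rw [hz, mul_inv_cancel₀ hu0, mul_one, mul_comm u e, mul_assoc, mul_inv_cancel₀ hu0, mul_one]
      rw [hMe, ← he, valueSetMod_smul_xPlus_mul_norm σ ϖ d m u hw1]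
  · rintro ⟨hV, hT, hsh, hL⟩
    refine ⟨hV, hT, hsh, fun hP => hne ?_⟩
    rw [LatticeLabelPlus] at hP
    rw [← hL, hP]

/-- Hence `cleanMinusFixCount σ ϖ d ℓ m mc T = cleanLabelFixCount σ ϖ d ℓ m mc u T` under (A″) at `T`, the index-two dictionary relative to `u` and `V_u ≠ V₊`.
[cite: Serre1979, Ch. V §3 Cor. 3] [cite: Rogawski1990, §4.9 Prop. 4.9.1 (b) p. 55] -/
theorem cleanMinusFixCount_eq_cleanLabelFixCount {σ : K →+* K} (hvσ : ∀ a, Valued.v (σ a) = Valued.v a) (ϖ : K) (d ℓ m mc : ℕ) (T : GL (Fin 3) K)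
    {u : K} (hσu : σ u = u) (hvu : Valued.v u = 1)
    (hdich : ∀ e : K, σ e = e → Valued.v e = 1 → (∃ z : K, z * σ z = e) ∨ ∃ z : K, z * σ z = u * e)
    (hne : valueSetMod σ ϖ m (u • xPlus σ ϖ d) ≠ valueSetMod σ ϖ m (xPlus σ ϖ d))
    (hA : ∀ M : Submodule (Valued.integer K) (Fin 3 → K), IsVertexLattice σ ϖ ((StdForm.antidiagonal 3).over K) 0 M → mapGL T M = M →
      LatticeNearTransvShell ϖ ℓ mc ((T : Matrix (Fin 3) (Fin 3) K) - 1) M →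
      ∃ e : K, σ e = e ∧ Valued.v e = 1 ∧ latticeValueSetMod σ ϖ m M ((T : Matrix (Fin 3) (Fin 3) K) - 1) = valueSetMod σ ϖ m (e • xPlus σ ϖ d)) :
    cleanMinusFixCount σ ϖ d ℓ m mc T = cleanLabelFixCount σ ϖ d ℓ m mc u T := by
  unfold cleanMinusFixCount cleanLabelFixCount
  rw [setOf_cleanMinus_eq_setOf_cleanLabel hvσ ϖ d ℓ m mc T hσu hvu hdich hne hA]

end OneLiteral

/-! ## §2  (α′) ∧ (A″) ∧ (β-BAL) ⇒ (β) -/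

section Head

variable {K : Type} [Field K] [Valued K ℤᵐ⁰] [CompleteSpace K] [Fintype 𝓀[K]]

/-- **(β) FROM THE LABEL DICHOTOMY AND THE κ-BALANCE.**  At one datum and schedules `N₀, mc` with `m* ≤ mc d`:
`LabelPlusCleanLawAt N₀ mc σ ϖ d t → CleanLabelDichotomyLawAt N₀ mc σ ϖ d t → CleanLabelKappaBalanceLawAt N₀ mc σ ϖ d t → CleanSgnFrameConstLawAt N₀ mc σ ϖ d t`.
Per frame `#T+ = cleanLabelFixCount … 1` ((α′), §1) and `#T−′ = cleanLabelFixCount … u` for the non-norm unit `u` of ★ NI2 ((A″), §1, `V_u ≠ V₊` by ★ `not_labelPlus_smul_xPlus`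
on the complete sheet), so the three κ-censuses of `#T+ − #T−′` are the balanced ones, and ★ `cleanSgnFrameConstLawAt_of_forall_sum_kappaChar` concludes.
[cite: Rogawski1990, §4.9 Prop. 4.9.1 (a)(b) p. 55, §4.10 p. 58] [cite: Serre1979, Ch. V §3 Cor. 3] [cite: LanglandsShelstad1987, §1.3, §3] -/
theorem cleanSgnFrameConstLawAt_of_dichotomy_of_balance (N₀ mc : ℕ → ℕ) (σ : K →+* K) (ϖ : K) (d t : ℕ) (hmc : mstarOfRecord d ≤ mc d)
    (hα : LabelPlusCleanLawAt N₀ mc σ ϖ d t) (hA : CleanLabelDichotomyLawAt N₀ mc σ ϖ d t) (hbal : CleanLabelKappaBalanceLawAt N₀ mc σ ϖ d t) :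
    CleanSgnFrameConstLawAt N₀ mc σ ϖ d t := by
  refine cleanSgnFrameConstLawAt_of_forall_sum_kappaChar N₀ mc σ ϖ d t fun hD f hf α β n₁ n₂ n₃ hE Γ hΓ i => ?_
  obtain ⟨-, hvσ, hϖ, -⟩ := id hD
  haveI : IsAdicComplete 𝓂[K] 𝒪[K] := isAdicComplete_valuedInteger_of_completeSpace hϖ
  obtain ⟨u, hσu, hvu, hun, hdich⟩ := exists_unit_nonnorm_dichotomy_of_isRamifiedQuadraticDatum σ ϖ d t hD
  have hϖ1 : Valued.v ϖ ≤ 1 := by rw [hϖ, ← WithZero.exp_zero, WithZero.exp_le_exp]; norm_num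
  have hne : ¬ LabelPlus σ ϖ d (mstarOfRecord d) (u • xPlus σ ϖ d) := not_labelPlus_smul_xPlus hD hσu fun z hz => hun ⟨z, hz⟩
  have hP : ∀ b : Fin 4, transvPlusFixCount σ ϖ d (d % 2) (mstarOfRecord d) (Γ b) = cleanLabelFixCount σ ϖ d (d % 2) (mstarOfRecord d) (mc d) 1 (Γ b) :=
    fun b => transvPlusFixCount_eq_cleanLabelFixCount_one σ hϖ1 d (d % 2) hmc (Γ b)
      fun M hV hT hsh hL => hα hD f hf α β n₁ n₂ n₃ hE Γ hΓ b M hV hT hsh hL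
  have hN : ∀ b : Fin 4, cleanMinusFixCount σ ϖ d (d % 2) (mstarOfRecord d) (mc d) (Γ b) = cleanLabelFixCount σ ϖ d (d % 2) (mstarOfRecord d) (mc d) u (Γ b) :=
    fun b => cleanMinusFixCount_eq_cleanLabelFixCount hvσ ϖ d (d % 2) (mstarOfRecord d) (mc d) (Γ b) hσu hvu hdich hne
      fun M hV hT hsh => hA hD f hf α β n₁ n₂ n₃ hE Γ hΓ b M hV hT hsh
  simp only [hP, hN, mul_sub, Finset.sum_sub_distrib]
  exact sub_eq_zero.2 (hbal hD f hf α β n₁ n₂ n₃ hE Γ hΓ u hσu hvu hun i)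

/-- The fenced form at one datum: `DyadicFence`s of (α′), (A″), (β-BAL) give the `DyadicFence` of (β). [cite: Rogawski1990, §4.9 Prop. 4.9.1 (a)(b) p. 55] -/
theorem dyadicFence_cleanSgnFrameConstLawAt_of_dichotomy_of_balance (N₀ mc : ℕ → ℕ) (σ : K →+* K) (ϖ : K) (d t : ℕ) (hmc : mstarOfRecord d ≤ mc d)
    (hα : DyadicFence (K := K) (LabelPlusCleanLawAt N₀ mc σ ϖ d t)) (hA : DyadicFence (K := K) (CleanLabelDichotomyLawAt N₀ mc σ ϖ d t))
    (hbal : DyadicFence (K := K) (CleanLabelKappaBalanceLawAt N₀ mc σ ϖ d t)) :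
    DyadicFence (K := K) (CleanSgnFrameConstLawAt N₀ mc σ ϖ d t) :=
  fun h2 => cleanSgnFrameConstLawAt_of_dichotomy_of_balance N₀ mc σ ϖ d t hmc (hα h2) (hA h2) (hbal h2)

end Head

/-! ## §3  The ED. 6 letter `stub_law_cleanSgn` modulo (A″) + (β-BAL) at the schedules of record -/

/-- **THE ED. 6 LETTER (β) MODULO ITS TWO REMAINING PRODUCERS.**  With (α′) PROVED at `(n0DerivedOfRecord, mcOfRecord)` (★ p859831 `labelPlusCleanLawAt_derived_ofRecord`) and
`m* ≤ m_c` (★ №5 `mstarOfRecord_le_mcOfRecord`): if (A″) `CleanLabelDichotomyLawAt` and (β-BAL) `CleanLabelKappaBalanceLawAt` hold (dyadically fenced) at every datum at the same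
schedules, then so does (β) — i.e. exactly the type of the tier-0 ED. 6 letter `stub_law_cleanSgn`. [cite: Rogawski1990, §4.9 Prop. 4.9.1 (a)(b) p. 55] [cite: LanglandsShelstad1987, §1.3] -/
theorem dyadicFence_cleanSgnFrameConstLawAt_derived_ofRecord_of
    (hA : ∀ {K : Type} [Field K] [Valued K ℤᵐ⁰] [CompleteSpace K] [Fintype 𝓀[K]] (σ : K →+* K) (ϖ : K) (d t : ℕ),
      DyadicFence (K := K) (CleanLabelDichotomyLawAt n0DerivedOfRecord mcOfRecord σ ϖ d t))
    (hbal : ∀ {K : Type} [Field K] [Valued K ℤᵐ⁰] [CompleteSpace K] [Fintype 𝓀[K]] (σ : K →+* K) (ϖ : K) (d t : ℕ),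
      DyadicFence (K := K) (CleanLabelKappaBalanceLawAt n0DerivedOfRecord mcOfRecord σ ϖ d t)) :
    ∀ {K : Type} [Field K] [Valued K ℤᵐ⁰] [CompleteSpace K] [Fintype 𝓀[K]] (σ : K →+* K) (ϖ : K) (d t : ℕ),
      DyadicFence (K := K) (CleanSgnFrameConstLawAt n0DerivedOfRecord mcOfRecord σ ϖ d t) :=
  fun σ ϖ d t => dyadicFence_cleanSgnFrameConstLawAt_of_dichotomy_of_balance n0DerivedOfRecord mcOfRecord σ ϖ d t (mstarOfRecord_le_mcOfRecord d)
    (dyadicFence_labelPlusCleanLawAt_derived_ofRecord σ ϖ d t) (hA σ ϖ d t) (hbal σ ϖ d t)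

end Summit.HodgeConjecture.HodgeConjecture.Cruxes.H413.F0P3cDyRamCleanSgnOfLabelDichotomy

end
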